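import Literature.Barriers.CriticalPhenomena.GridSAWStructuredDrawingCompose
import HarnessLib

/-!
# Outer return paths: long edges routed around a boxed grid drawing

A device of the grid drawing `E₀` of the `#3SAT ≤ #HamPath` gadget graph (Liśkiewicz–Ogihara–Toda
2003, Theorem 7 / Lemma 4, tree fact `GridSAW.LOT2003_lemma4_gadgets`) for the grid-native
construction `Literature.Combinatorics.SimpleGraph.GridFormula.graphOf ψ`: its chain of cells runs
through the rows of the variable/column matrix ALWAYS LEFT TO RIGHT (tile `(i, j)` of every row sits
in column `j`, so that the column chords are short), hence the chain edge from the end of row `i`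
to the start of row `i + 1` is a LONG edge. It cannot cross the inter-row corridor (the column
chords live there); it is routed AROUND the drawing: east, down the east margin, west below
everything, up the west margin, east into the start of the next row — the **outer return path**
`uPath`. Successive returns are nested `U`-shapes and are pairwise disjoint as soon as their
margins `d` and their end heights are strictly monotone (`uPath_disjoint`); a return meets the
half-box of the drawing only at its two ends (`eq_ends_of_mem_uPath`). Packaged for the compose kit
(`GridSAWStructuredDrawingCompose.lean`): **`SDrawing.newEdgesOK_returns`** — for a valid drawing
inside the half-box `[xW, xE] × [yS, ∞)`, a family of returns with ends on the east/west sides,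
strictly monotone data, no old edge between the two ends and degree budget is `NewEdgesOK`, so
`IsValid.addEdges` applies.

Also: axis-parallel **polylines** (`steps`, `polyline`, with `isChain_cons_polyline`,
`getLast?_cons_polyline`, membership), of independent use for connectors.

## References

* M. Liśkiewicz, M. Ogihara, S. Toda, TCS 304 (2003) 129–156, §4 (proof of Theorem 7: the
  embedding `E₀`, edges as vertex-disjoint grid paths).
-/

namespace Literature.Barriers.CriticalPhenomena.GridSAW

/-! ### Directed runs of unit steps and polylines -/

/-- The four axis directions. [folklore] -/
inductive Dir
  | E
  | W
  | N
  | S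
  deriving DecidableEq, Repr

namespace Dir

/-- The point `k` unit steps from `q` in direction `dir`. [folklore] -/
def move : Dir → GridPoint → ℤ → GridPoint
  | E, q, k => (q.1 + k, q.2)
  | W, q, k => (q.1 - k, q.2)
  | N, q, k => (q.1, q.2 + k)
  | S, q, k => (q.1, q.2 - k)

/-- Consecutive points of a run are grid-adjacent. [folklore] -/
theorem isGridEdge_move_succ : ∀ (dir : Dir) (q : GridPoint) (k : ℤ), IsGridEdge (dir.move q k) (dir.move q (k + 1))
  | E, q, k => Or.inr ⟨rfl, by show (q.1 + k - (q.1 + (k + 1))).natAbs = 1; omega⟩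
  | W, q, k => Or.inr ⟨rfl, by show (q.1 - k - (q.1 - (k + 1))).natAbs = 1; omega⟩
  | N, q, k => Or.inl ⟨rfl, by show (q.2 + k - (q.2 + (k + 1))).natAbs = 1; omega⟩
  | S, q, k => Or.inl ⟨rfl, by show (q.2 - k - (q.2 - (k + 1))).natAbs = 1; omega⟩

/-- `move` by `0` is the identity. [folklore] -/
@[simp] theorem move_zero (dir : Dir) (q : GridPoint) : dir.move q 0 = q := by
  cases dir <;> simp [move]

end Dir

/-- **The run of `n` unit steps from `q` in direction `dir`** (the start `q` excluded):
`move q 1, …, move q n`. [folklore] -/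
def steps (dir : Dir) (q : GridPoint) (n : ℕ) : List GridPoint := (List.range n).map fun i : ℕ => dir.move q ((i : ℤ) + 1)

/-- **The axis-parallel polyline** from `q` along the legs `(dir, n)` (the start `q` excluded). [folklore] -/
def polyline : GridPoint → List (Dir × ℕ) → List GridPoint
  | _, [] => []
  | q, (dir, n) :: legs => steps dir q n ++ polyline (dir.move q n) legs

/-- The end point of a polyline. [folklore] -/
def polyEnd : GridPoint → List (Dir × ℕ) → GridPoint
  | q, [] => q
  | q, (dir, n) :: legs => polyEnd (dir.move q n) legs

/-- Points of an eastward run. [folklore] -/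
theorem mem_steps_E {q p : GridPoint} {n : ℕ} : p ∈ steps .E q n ↔ p.2 = q.2 ∧ q.1 < p.1 ∧ p.1 ≤ q.1 + n := by
  unfold steps
  rw [List.mem_map]
  simp only [List.mem_range, Dir.move]
  constructor
  · rintro ⟨i, hi, rfl⟩; dsimp only; omega
  · rintro ⟨hy, h1, h2⟩
    refine ⟨(p.1 - q.1 - 1).toNat, by omega, ?_⟩
    rw [Int.toNat_of_nonneg (by omega)]; ext <;> dsimp only <;> omega

/-- Points of a westward run. [folklore] -/
theorem mem_steps_W {q p : GridPoint} {n : ℕ} : p ∈ steps .W q n ↔ p.2 = q.2 ∧ q.1 - n ≤ p.1 ∧ p.1 < q.1 := by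
  unfold steps
  rw [List.mem_map]
  simp only [List.mem_range, Dir.move]
  constructor
  · rintro ⟨i, hi, rfl⟩; dsimp only; omega
  · rintro ⟨hy, h1, h2⟩
    refine ⟨(q.1 - p.1 - 1).toNat, by omega, ?_⟩
    rw [Int.toNat_of_nonneg (by omega)]; ext <;> dsimp only <;> omega

/-- Points of a northward run. [folklore] -/
theorem mem_steps_N {q p : GridPoint} {n : ℕ} : p ∈ steps .N q n ↔ p.1 = q.1 ∧ q.2 < p.2 ∧ p.2 ≤ q.2 + n := by
  unfold steps
  rw [List.mem_map]
  simp only [List.mem_range, Dir.move]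
  constructor
  · rintro ⟨i, hi, rfl⟩; dsimp only; omega
  · rintro ⟨hx, h1, h2⟩
    refine ⟨(p.2 - q.2 - 1).toNat, by omega, ?_⟩
    rw [Int.toNat_of_nonneg (by omega)]; ext <;> dsimp only <;> omega

/-- Points of a southward run. [folklore] -/
theorem mem_steps_S {q p : GridPoint} {n : ℕ} : p ∈ steps .S q n ↔ p.1 = q.1 ∧ q.2 - n ≤ p.2 ∧ p.2 < q.2 := by
  unfold steps
  rw [List.mem_map]
  simp only [List.mem_range, Dir.move]
  constructor
  · rintro ⟨i, hi, rfl⟩; dsimp only; omega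
  · rintro ⟨hx, h1, h2⟩
    refine ⟨(q.2 - p.2 - 1).toNat, by omega, ?_⟩
    rw [Int.toNat_of_nonneg (by omega)]; ext <;> dsimp only <;> omega

/-- A run is self-avoiding. [folklore] -/
theorem nodup_steps (dir : Dir) (q : GridPoint) (n : ℕ) : (steps dir q n).Nodup :=
  (List.nodup_range).map fun i j hij => by
    cases dir <;> simp only [Dir.move, Prod.mk.injEq] at hij <;> omega

/-- A run preceded by its start is a grid path. [folklore] -/
theorem isChain_cons_steps (dir : Dir) (q : GridPoint) (n : ℕ) : List.IsChain IsGridEdge (q :: steps dir q n) := by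
  unfold steps
  cases n with
  | zero => simp
  | succ n =>
    rw [List.range_succ_eq_map, List.map_cons, List.map_map]
    refine List.IsChain.cons_cons ?_ ?_
    · simpa using dir.isGridEdge_move_succ q 0
    · have : List.IsChain IsGridEdge ((List.range (n + 1)).map fun i : ℕ => dir.move q ((i : ℤ) + 1)) := by
        refine List.isChain_map_of_isChain (R := fun i j : ℕ => j = i + 1) _ (fun i j hij => ?_) ?_
        · subst hij
          push_cast
          exact dir.isGridEdge_move_succ q _
        · exact List.isChain_range_succ _ _ |>.mpr fun _ _ => rfl
      rw [List.range_succ_eq_map, List.map_cons, List.map_map] at this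
      exact this

/-- The last point of a run preceded by its start. [folklore] -/
theorem getLast?_cons_steps (dir : Dir) (q : GridPoint) (n : ℕ) : (q :: steps dir q n).getLast? = some (dir.move q n) := by
  unfold steps
  cases n with
  | zero => simp
  | succ m =>
    rw [List.getLast?_cons, List.getLast?_map, List.getLast?_range]
    simp

/-- Appending to a grid path a grid path that starts where the first ends. [folklore] -/
theorem isChain_append_of_getLast? {l r : List GridPoint} {c : GridPoint} (hl : List.IsChain IsGridEdge l)
    (hc : l.getLast? = some c) (hr : List.IsChain IsGridEdge (c :: r)) : List.IsChain IsGridEdge (l ++ r) := by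
  rw [List.isChain_append]
  refine ⟨hl, hr.tail, fun a ha b hb => ?_⟩
  rw [hc, Option.mem_def, Option.some.injEq] at ha
  subst ha
  cases r with
  | nil => simp at hb
  | cons b' r =>
    simp only [List.head?_cons, Option.mem_def, Option.some.injEq] at hb
    subst hb
    exact (List.isChain_cons_cons.1 hr).1

/-- The last point of an appended list. [folklore] -/
theorem getLast?_append_of_getLast? {l r : List GridPoint} {c c' : GridPoint} (hc : l.getLast? = some c)
    (hr : (c :: r).getLast? = some c') : (l ++ r).getLast? = some c' := by
  rw [List.getLast?_append]
  cases r with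
  | nil =>
    simp only [List.getLast?_singleton, Option.some.injEq] at hr
    subst hr
    simpa using hc
  | cons b r => simpa [List.getLast?_cons_cons] using hr

/-- **A polyline preceded by its start is a grid path.** [folklore] -/
theorem isChain_cons_polyline : ∀ (q : GridPoint) (legs : List (Dir × ℕ)), List.IsChain IsGridEdge (q :: polyline q legs)
  | q, [] => by simp [polyline]
  | q, (dir, n) :: legs => by
    rw [polyline, ← List.cons_append]
    exact isChain_append_of_getLast? (isChain_cons_steps dir q n) (getLast?_cons_steps dir q n)
      (isChain_cons_polyline _ legs)

/-- **The last point of a polyline** preceded by its start. [folklore] -/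
theorem getLast?_cons_polyline : ∀ (q : GridPoint) (legs : List (Dir × ℕ)),
    (q :: polyline q legs).getLast? = some (polyEnd q legs)
  | q, [] => by simp [polyline, polyEnd]
  | q, (dir, n) :: legs => by
    rw [polyline, ← List.cons_append, polyEnd]
    exact getLast?_append_of_getLast? (getLast?_cons_steps dir q n) (getLast?_cons_polyline _ legs)

/-- Points of a polyline with one more leg. [folklore] -/
theorem mem_polyline_cons {q p : GridPoint} {dir : Dir} {n : ℕ} {legs : List (Dir × ℕ)} :
    p ∈ polyline q ((dir, n) :: legs) ↔ p ∈ steps dir q n ∨ p ∈ polyline (dir.move q n) legs := by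
  rw [polyline, List.mem_append]

/-- The empty polyline. [folklore] -/
@[simp] theorem polyline_nil (q : GridPoint) : polyline q [] = [] := rfl

/-! ### The outer return path -/

section UPath

variable (xW xE yS : ℤ) (d : ℕ) (yE yW : ℤ)

/-- The legs of the outer return: east `d + 1`, south to depth `yS - d - 1`, west to `xW - d - 1`,
north to height `yW`, east `d + 1`. [folklore] -/
def uLegs : List (Dir × ℕ) :=
  [(.E, d + 1), (.S, (yE - yS).toNat + d + 1), (.W, (xE - xW).toNat + 2 * d + 2), (.N, (yW - yS).toNat + d + 1), (.E, d + 1)]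

/-- **The outer return path** with margin `d` around the half-box `[xW, xE] × [yS, ∞)`, from
`(xE, yE)` to `(xW, yW)`. [cite: LiskiewiczOgiharaToda2003, §4 (proof of Theorem 7: edges as grid paths)] -/
def uPath : List GridPoint := (xE, yE) :: polyline (xE, yE) (uLegs xW xE yS d yE yW)

variable {xW xE yS d yE yW}

/-- **The points of the outer return path.** [folklore] -/
theorem mem_uPath_iff (hx : xW ≤ xE) (hyE : yS ≤ yE) (hyW : yS ≤ yW) {p : GridPoint} :
    p ∈ uPath xW xE yS d yE yW ↔
      (p.2 = yE ∧ xE ≤ p.1 ∧ p.1 ≤ xE + d + 1) ∨ (p.1 = xE + d + 1 ∧ yS - d - 1 ≤ p.2 ∧ p.2 < yE) ∨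
        (p.2 = yS - d - 1 ∧ xW - d - 1 ≤ p.1 ∧ p.1 < xE + d + 1) ∨ (p.1 = xW - d - 1 ∧ yS - d - 1 < p.2 ∧ p.2 ≤ yW) ∨
          (p.2 = yW ∧ xW - d - 1 < p.1 ∧ p.1 ≤ xW) := by
  unfold uPath uLegs
  simp only [List.mem_cons, mem_polyline_cons, polyline_nil, List.not_mem_nil, or_false, mem_steps_E, mem_steps_W,
    mem_steps_N, mem_steps_S, Dir.move]
  have h1 : ((yE - yS).toNat : ℤ) = yE - yS := Int.toNat_of_nonneg (by omega)
  have h2 : ((xE - xW).toNat : ℤ) = xE - xW := Int.toNat_of_nonneg (by omega)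
  have h3 : ((yW - yS).toNat : ℤ) = yW - yS := Int.toNat_of_nonneg (by omega)
  push_cast
  rw [h1, h2, h3]
  constructor
  · rintro (rfl | h | h | h | h | h) <;> omega
  · rintro (h | h | h | h | h)
    · by_cases hp : p.1 = xE
      · left; ext <;> simp [hp, h.1]
      · right; left; omega
    · right; right; left; omega
    · right; right; right; left; omega
    · right; right; right; right; left; omega
    · right; right; right; right; right; omega

/-- The outer return path starts at `(xE, yE)`. [folklore] -/
theorem head?_uPath : (uPath xW xE yS d yE yW).head? = some (xE, yE) := rfl

/-- **The outer return path is a grid path.** [folklore] -/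
theorem isChain_uPath : List.IsChain IsGridEdge (uPath xW xE yS d yE yW) :=
  isChain_cons_polyline _ _

/-- **The outer return path ends at `(xW, yW)`.** [folklore] -/
theorem getLast?_uPath (hx : xW ≤ xE) (hyE : yS ≤ yE) (hyW : yS ≤ yW) :
    (uPath xW xE yS d yE yW).getLast? = some (xW, yW) := by
  rw [uPath, getLast?_cons_polyline]
  congr 1
  simp only [uLegs, polyEnd, Dir.move]
  have h1 : ((yE - yS).toNat : ℤ) = yE - yS := Int.toNat_of_nonneg (by omega)
  have h2 : ((xE - xW).toNat : ℤ) = xE - xW := Int.toNat_of_nonneg (by omega)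
  have h3 : ((yW - yS).toNat : ℤ) = yW - yS := Int.toNat_of_nonneg (by omega)
  push_cast
  rw [h1, h2, h3]
  ext <;> dsimp only <;> ring

/-- **The outer return path is self-avoiding.** [folklore] -/
theorem nodup_uPath (hx : xW < xE) (hyE : yS ≤ yE) (hyW : yS ≤ yW) : (uPath xW xE yS d yE yW).Nodup := by
  have h1 : ((yE - yS).toNat : ℤ) = yE - yS := Int.toNat_of_nonneg (by omega)
  have h2 : ((xE - xW).toNat : ℤ) = xE - xW := Int.toNat_of_nonneg (by omega)
  have h3 : ((yW - yS).toNat : ℤ) = yW - yS := Int.toNat_of_nonneg (by omega)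
  unfold uPath uLegs
  simp only [polyline, Dir.move, List.append_nil]
  push_cast
  rw [h1, h2, h3]
  refine List.nodup_cons.2 ⟨fun h => ?_, ?_⟩
  · simp only [List.mem_append, mem_steps_E, mem_steps_W, mem_steps_N, mem_steps_S] at h
    push_cast at h
    omega
  · refine List.nodup_append.2 ⟨nodup_steps _ _ _, ?_, ?_⟩
    refine List.nodup_append.2 ⟨nodup_steps _ _ _, ?_, ?_⟩
    refine List.nodup_append.2 ⟨nodup_steps _ _ _, ?_, ?_⟩
    refine List.nodup_append.2 ⟨nodup_steps _ _ _, nodup_steps _ _ _, ?_⟩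
    all_goals
      intro p hp q hq hpq; subst hpq
      simp only [List.mem_append, mem_steps_E, mem_steps_W, mem_steps_N, mem_steps_S] at hp hq
      push_cast at hp hq
      omega

/-- **A point of the return path inside the half-box is one of its two ends.** [folklore] -/
theorem eq_ends_of_mem_uPath (hx : xW ≤ xE) (hyE : yS ≤ yE) (hyW : yS ≤ yW) {p : GridPoint}
    (hp : p ∈ uPath xW xE yS d yE yW) (h1 : xW ≤ p.1) (h2 : p.1 ≤ xE) (h3 : yS ≤ p.2) :
    p = (xE, yE) ∨ p = (xW, yW) := by
  rw [mem_uPath_iff hx hyE hyW] at hp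
  rcases hp with h | h | h | h | h
  · left; ext <;> dsimp only <;> omega
  · omega
  · omega
  · omega
  · right; ext <;> dsimp only <;> omega

/-- **Nested returns are disjoint**: margins and both end heights strictly monotone. [folklore] -/
theorem uPath_disjoint (hx : xW < xE) {d d' : ℕ} {yE yW yE' yW' : ℤ} (hyE : yS ≤ yE) (hyW : yS ≤ yW)
    (hd : d < d') (hE : yE < yE') (hW : yW < yW') {p : GridPoint}
    (hp : p ∈ uPath xW xE yS d yE yW) (hp' : p ∈ uPath xW xE yS d' yE' yW') : False := by
  rw [mem_uPath_iff (le_of_lt hx) hyE hyW] at hp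
  rw [mem_uPath_iff (le_of_lt hx) (by omega) (by omega)] at hp'
  omega

end UPath

/-! ### Returns as admissible new edges of a boxed drawing -/

namespace SDrawing

variable {α : Type*} [DecidableEq α]

/-- **A return**: the two ends `a`, `b`, the margin `d`, and the end heights `yE`, `yW`. [folklore] -/
abbrev Return (α : Type*) : Type _ := α × α × ℕ × ℤ × ℤ

/-- The drawn edge of a return around the half-box `[xW, xE] × [yS, ∞)`. [folklore] -/
def Return.edge (xW xE yS : ℤ) (r : Return α) : SEdge α := (r.1, r.2.1, uPath xW xE yS r.2.2.1 r.2.2.2.1 r.2.2.2.2)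

/-- **Hypotheses on a family of returns** around a drawing `S` in the half-box `[xW, xE] × [yS, ∞)`:
the drawing lies in the half-box; each return starts at a vertex drawn on the east side at its
height `yE ≥ yS` and ends at a vertex on the west side at its height `yW ≥ yS`; margins and both
heights are strictly monotone across the family (nesting); no old edge joins the two ends; the
degrees allow the new edges. [folklore] -/
structure ReturnsOK (S : SDrawing α) (xW xE yS : ℤ) (R : List (Return α)) : Prop where
  /-- the box is nondegenerate -/
  lt : xW < xE
  /-- the drawing lies in the half-box -/
  inBox : ∀ p ∈ S.points, xW ≤ p.1 ∧ p.1 ≤ xE ∧ yS ≤ p.2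
  /-- the east end -/
  fst_ok : ∀ r ∈ R, r.1 ∈ S.verts ∧ S.pos r.1 = (xE, r.2.2.2.1) ∧ yS ≤ r.2.2.2.1
  /-- the west end -/
  snd_ok : ∀ r ∈ R, r.2.1 ∈ S.verts ∧ S.pos r.2.1 = (xW, r.2.2.2.2) ∧ yS ≤ r.2.2.2.2
  /-- nesting -/
  nested : R.Pairwise fun r r' =>
    (r.2.2.1 < r'.2.2.1 ∧ r.2.2.2.1 < r'.2.2.2.1 ∧ r.2.2.2.2 < r'.2.2.2.2) ∨
      (r'.2.2.1 < r.2.2.1 ∧ r'.2.2.2.1 < r.2.2.2.1 ∧ r'.2.2.2.2 < r.2.2.2.2)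
  /-- no old edge between the ends -/
  fresh : ∀ r ∈ R, ∀ e' ∈ S.edges, ¬ SameEndsS (Return.edge xW xE yS r) e'
  /-- degree budget -/
  degree_le : ∀ v ∈ S.verts, S.degree v + R.countP (fun r => decide (r.1 = v ∨ r.2.1 = v)) ≤ 3

/-- **Returns around a valid boxed drawing are admissible new edges.**
[cite: LiskiewiczOgiharaToda2003, §4 (proof of Theorem 7: "no vertex congestion")] -/
theorem newEdgesOK_returns {S : SDrawing α} (hS : S.IsValid) {xW xE yS : ℤ} {R : List (Return α)}
    (h : ReturnsOK S xW xE yS R) : NewEdgesOK S (R.map (Return.edge xW xE yS)) := by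
  have hle : xW ≤ xE := le_of_lt h.lt
  have mem_of : ∀ {e}, e ∈ R.map (Return.edge xW xE yS) → ∃ r ∈ R, Return.edge xW xE yS r = e := fun he => List.mem_map.1 he
  -- a point of a return in the half-box is the image of one of its ends
  have key : ∀ r ∈ R, ∀ p ∈ uPath xW xE yS r.2.2.1 r.2.2.2.1 r.2.2.2.2, xW ≤ p.1 ∧ p.1 ≤ xE ∧ yS ≤ p.2 →
      p = S.pos r.1 ∨ p = S.pos r.2.1 := by
    intro r hr p hp hb
    obtain ⟨-, h1, hy1⟩ := h.fst_ok r hr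
    obtain ⟨-, h2, hy2⟩ := h.snd_ok r hr
    rw [h1, h2]
    exact eq_ends_of_mem_uPath hle hy1 hy2 hp hb.1 hb.2.1 hb.2.2
  refine ⟨?_, ?_, ?_, ?_, ?_, ?_, ?_, ?_, ?_, ?_, ?_, ?_, ?_⟩
  · intro e he; obtain ⟨r, hr, rfl⟩ := mem_of he; exact (h.fst_ok r hr).1
  · intro e he; obtain ⟨r, hr, rfl⟩ := mem_of he; exact (h.snd_ok r hr).1
  · intro e he; obtain ⟨⟨a, b, d, yE, yW⟩, hr, rfl⟩ := mem_of he
    intro hab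
    change a = b at hab
    have := (h.fst_ok _ hr).2.1
    dsimp only at this hab
    rw [hab, (h.snd_ok _ hr).2.1, Prod.mk.injEq] at this
    exact absurd this.1 (ne_of_lt h.lt)
  · intro e he; obtain ⟨⟨a, b, d, yE, yW⟩, hr, rfl⟩ := mem_of he
    show (uPath xW xE yS d yE yW).head? = some (S.pos a)
    rw [head?_uPath, (h.fst_ok _ hr).2.1]
  · intro e he; obtain ⟨⟨a, b, d, yE, yW⟩, hr, rfl⟩ := mem_of he
    show (uPath xW xE yS d yE yW).getLast? = some (S.pos b)
    rw [getLast?_uPath hle (h.fst_ok _ hr).2.2 (h.snd_ok _ hr).2.2, (h.snd_ok _ hr).2.1]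
  · intro e he; obtain ⟨r, hr, rfl⟩ := mem_of he
    exact nodup_uPath h.lt (h.fst_ok r hr).2.2 (h.snd_ok r hr).2.2
  · intro e he; obtain ⟨r, hr, rfl⟩ := mem_of he
    exact isChain_uPath
  · -- interior: a vertex image on the path is an end
    intro e he v hv hpv; obtain ⟨r, hr, rfl⟩ := mem_of he
    have hb := h.inBox _ (S.pos_mem_points hv)
    rcases key r hr _ hpv hb with hp | hp
    · exact Or.inl (hS.pos_inj v hv r.1 (h.fst_ok r hr).1 hp)
    · exact Or.inr (hS.pos_inj v hv r.2.1 (h.snd_ok r hr).1 hp)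
  · -- a common point with an old edge is a vertex image
    intro e he e' he' p hp hp'; obtain ⟨r, hr, rfl⟩ := mem_of he
    have hb := h.inBox _ (S.path_mem_points he' hp')
    rcases key r hr p hp hb with rfl | rfl
    · exact ⟨r.1, (h.fst_ok r hr).1, rfl⟩
    · exact ⟨r.2.1, (h.snd_ok r hr).1, rfl⟩
  · -- two returns never meet
    refine (List.pairwise_map.2 (h.nested.imp_of_mem fun {r r'} hr hr' hrr => ?_))
    intro p hp hp'
    exfalso
    rcases hrr with ⟨hd, hE, hW⟩ | ⟨hd, hE, hW⟩
    · exact uPath_disjoint h.lt (h.fst_ok r hr).2.2 (h.snd_ok r hr).2.2 hd hE hW hp hp'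
    · exact uPath_disjoint h.lt (h.fst_ok r' hr').2.2 (h.snd_ok r' hr').2.2 hd hE hW hp' hp
  · intro e he e' he'; obtain ⟨r, hr, rfl⟩ := mem_of he
    exact h.fresh r hr e' he'
  · refine (List.pairwise_map.2 (h.nested.imp_of_mem fun {r r'} hr hr' hrr => ?_))
    obtain ⟨a, b, d, yE, yW⟩ := r
    obtain ⟨a', b', d', yE', yW'⟩ := r'
    have p1 := (h.fst_ok _ hr).2.1
    have p2' := (h.snd_ok _ hr').2.1
    have p1' := (h.fst_ok _ hr').2.1
    dsimp only at p1 p2' p1' hrr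
    rintro (⟨h1, -⟩ | ⟨h1, -⟩)
    · change a = a' at h1
      rw [h1, p1', Prod.mk.injEq] at p1
      rcases hrr with ⟨-, hE, -⟩ | ⟨-, hE, -⟩ <;> exact absurd p1.2 (by omega)
    · change a = b' at h1
      rw [h1, p2', Prod.mk.injEq] at p1
      exact absurd p1.1 (ne_of_lt h.lt)
  · intro v hv
    have := h.degree_le v hv
    rwa [List.countP_map]

/-- **Adding the returns to a valid boxed drawing keeps it valid.**
[cite: LiskiewiczOgiharaToda2003, §4 (proof of Theorem 7, E₀)] -/
theorem IsValid.addReturns {S : SDrawing α} (hS : S.IsValid) {xW xE yS : ℤ} {R : List (Return α)}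
    (h : ReturnsOK S xW xE yS R) : (S.addEdges (R.map (Return.edge xW xE yS))).IsValid :=
  hS.addEdges (newEdgesOK_returns hS h)

end SDrawing

end Literature.Barriers.CriticalPhenomena.GridSAW
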